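import Literature.RepresentationTheory.HeisenbergGroup.HeisenbergGroup
import Mathlib.Tactic.Ring
import Mathlib.Tactic.LinearCombination
import HarnessLib

/-!
# Cohomologous laws give isomorphic Heisenberg groups; the symplectic law `½φ` versus the polarised law `β x y'`

Topic `RepresentationTheory/HeisenbergGroup`; namespace `Literature.RepresentationTheory.HeisenbergGroup`.  KERNEL ONLY:
five definitions with bodies (`Heisenberg.coboundaryEquiv`, `Heisenberg.map`, `Heisenberg.congrEquiv`, `altPolar`,
`halfAltPolarEquiv`) and proved theorems; no named fact, no record, no `sorry`.

The tree's `Heisenberg B` (`HeisenbergGroup.lean`) is the group `V × R` with law `(v, t)(w, s) = (v + w, t + s + B v w)`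
for an arbitrary bilinear `B : V →ₗ[R] V →ₗ[R] R`.  Two laws occur for one symplectic space `(W, φ)` with a complete
polarisation `W = X ⊕ Y`: the SYMPLECTIC law `B = ½φ` ([MoeglinVignerasWaldspurger1987, Chap. 2 I.1]
"`(w, t)(w', t') = (w + w', t + t' + ½⟨w, w'⟩)`"; the rendering R6 of the tree's `Prop311AsPrinted` of
[GelbartRogawski1991, §3.1 p. 454 L17–19] "`H(W) = W ⊕ F` … As usual") and the POLARISED law `polar β`,
`((x, y), t)((x', y'), t') = ((x + x', y + y'), t + t' + β x y')` ([Weil1964, Chap. I n° 4], the form in which the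
tree's Schrödinger models and Stone–von Neumann files are written).  They differ by the coboundary of
`q(x, y) = ½ β x y`.  This file records the isomorphism once and for all:

* §1 **`Heisenberg.coboundaryEquiv`**: if `B' v w = B v w + (q(v + w) - q v - q w)` for some function `q : V → R`, then
  `(v, t) ↦ (v, t + q v)` is a group isomorphism `Heisenberg B ≃* Heisenberg B'`, the identity on the centre
  (`coboundaryEquiv_ofCenter`) and over `V` (`coboundaryEquiv_apply_v`); **`Heisenberg.map`**: functoriality
  `(v, t) ↦ (j v, k t)` for additive `j`, `k` with `C (j v) (j w) = k (B v w)` (the inclusions of `H(W_∞)`, `H(W_fin)`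
  into `H_𝐀(W)`); **`Heisenberg.congrEquiv`**: transport `(v, t) ↦ (e v, t)` along a linear equivalence `e : V ≃ V'`
  (`Heisenberg (C ∘ (e × e)) ≃* Heisenberg C`, e.g. a Darboux basis `W ≃ X × Y`);
* §2 **`altPolar β = polar β - (polar β)ᵀ`**, the alternating form `φ((x, y), (x', y')) = β x y' - β x' y` of a polarised
  pairing, and, when `2` is invertible in `R`, **`halfAltPolarEquiv β : Heisenberg (⅟2 • altPolar β) ≃* Heisenberg (polar β)`**,
  `((x, y), t) ↦ ((x, y), t + ½ β x y)` — MVW's `H(W)` for `W = X ⊕ Y` identified with Weil's `A(X)`.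

Consumers: transporting a representation of the adelic (or local) Heisenberg group `Heisenberg (½φ_𝐀)` restricted to
a Lagrangian decomposition to the polarised group `Heisenberg (polar β)` of `DualLatticePair.lean` /
`StoneVonNeumannLatticePair.lean` (compose with `(halfAltPolarEquiv β).symm.toMonoidHom`); central characters are
unchanged (`halfAltPolarEquiv_ofCenter`).  Nothing of the cited sources is asserted.

## References
* [MoeglinVignerasWaldspurger1987] C. Mœglin, M.-F. Vignéras, J.-L. Waldspurger, LNM 1291 (1987), Chap. 2 I.1 (the law
  of `H(W)`), II.1.
* [Weil1964] A. Weil, Acta Math. 111 (1964), Chap. I n° 3–4 (the group `A(G)`, bicharacter `F`, cohomologous `F`).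
* [GelbartRogawski1991] S. Gelbart, J. Rogawski, Invent. Math. 105 (1991), §3.1 p. 454 L17–19.
-/

set_option autoImplicit false

namespace Literature.RepresentationTheory.HeisenbergGroup

variable {R : Type*} [CommRing R]

/-! ## §1 Cohomologous laws -/

namespace Heisenberg

variable {V : Type*} [AddCommGroup V] [Module R V] (B B' : V →ₗ[R] V →ₗ[R] R) (q : V → R)

/-- a correcting function vanishes at `0` (put `v = w = 0` in the coboundary relation). [cite: Weil1964, Chap. I n° 3] -/
theorem eq_zero_of_coboundary (hq : ∀ v w : V, B' v w = B v w + (q (v + w) - q v - q w)) : q 0 = 0 := by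
  have h := hq 0 0
  simp only [map_zero, add_zero, zero_add, sub_self, zero_sub] at h
  exact neg_eq_zero.1 h.symm

/-- **cohomologous laws give isomorphic Heisenberg groups**: if `B' v w = B v w + (q(v + w) - q v - q w)` then
`(v, t) ↦ (v, t + q v)` is a group isomorphism `Heisenberg B ≃* Heisenberg B'` (Weil: bicharacters differing by the
coboundary of a "caractère du second degré" define the same group `A(G)` up to isomorphism).
[cite: Weil1964, Chap. I n° 3–4] -/
def coboundaryEquiv (hq : ∀ v w : V, B' v w = B v w + (q (v + w) - q v - q w)) : Heisenberg B ≃* Heisenberg B' where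
  toFun h := ⟨h.v, h.t + q h.v⟩
  invFun h := ⟨h.v, h.t - q h.v⟩
  left_inv h := by
    apply Heisenberg.ext
    · rfl
    · show h.t + q h.v - q h.v = h.t
      rw [add_sub_cancel_right]
  right_inv h := by
    apply Heisenberg.ext
    · rfl
    · show h.t - q h.v + q h.v = h.t
      rw [sub_add_cancel]
  map_mul' a b := by
    apply Heisenberg.ext
    · rfl
    · show (a * b).t + q (a * b).v = (a.t + q a.v) + (b.t + q b.v) + B' a.v b.v
      rw [Heisenberg.mul_t, Heisenberg.mul_v, hq]
      ring

variable {B B' q} (hq : ∀ v w : V, B' v w = B v w + (q (v + w) - q v - q w))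

/-- `coboundaryEquiv` is the identity on the `V`-component. [cite: Weil1964, Chap. I n° 3–4] -/
@[simp] theorem coboundaryEquiv_apply_v (h : Heisenberg B) : (coboundaryEquiv B B' q hq h).v = h.v := rfl

/-- `coboundaryEquiv` shifts the central component by `q v`. [cite: Weil1964, Chap. I n° 3–4] -/
@[simp] theorem coboundaryEquiv_apply_t (h : Heisenberg B) : (coboundaryEquiv B B' q hq h).t = h.t + q h.v := rfl

/-- the inverse shifts back. [cite: Weil1964, Chap. I n° 3–4] -/
@[simp] theorem coboundaryEquiv_symm_apply_v (h : Heisenberg B') : ((coboundaryEquiv B B' q hq).symm h).v = h.v := rfl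

/-- the inverse shifts back. [cite: Weil1964, Chap. I n° 3–4] -/
@[simp] theorem coboundaryEquiv_symm_apply_t (h : Heisenberg B') :
    ((coboundaryEquiv B B' q hq).symm h).t = h.t - q h.v := rfl

/-- `coboundaryEquiv` is the identity on the centre `{(0, t)}`. [cite: Weil1964, Chap. I n° 3–4] -/
theorem coboundaryEquiv_ofCenter (t : Multiplicative R) :
    coboundaryEquiv B B' q hq (ofCenter B t) = ofCenter B' t := by
  apply Heisenberg.ext
  · rfl
  · show Multiplicative.toAdd t + q 0 = Multiplicative.toAdd t
    rw [eq_zero_of_coboundary B B' q hq, add_zero]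

/-- `coboundaryEquiv` on an element `(v, 0)`. [cite: Weil1964, Chap. I n° 3–4] -/
theorem coboundaryEquiv_mk_zero (v : V) : coboundaryEquiv B B' q hq ⟨v, 0⟩ = ⟨v, q v⟩ := by
  apply Heisenberg.ext
  · rfl
  · show 0 + q v = q v
    rw [zero_add]

/-! ### Functoriality: additive maps compatible with the forms, and transport along a linear equivalence -/

section Map

variable {R' : Type*} [CommRing R'] {V' : Type*} [AddCommGroup V'] [Module R' V'] (C : V' →ₗ[R'] V' →ₗ[R'] R')
  (j : V →+ V') (k : R →+ R')

/-- **functoriality of `Heisenberg`**: additive maps `j : V → V'`, `k : R → R'` with `C (j v) (j w) = k (B v w)` induce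
the group homomorphism `(v, t) ↦ (j v, k t) : Heisenberg B →* Heisenberg C` — e.g. the inclusion of the archimedean or
the finite-adelic Heisenberg group into the adelic one (`k = (·, 0)` or `(0, ·)` into `𝐀 = 𝐀_∞ × 𝐀_fin`), whose
images commute by `Heisenberg.commute_iff`. [cite: Weil1964, Chap. I n° 3–4] -/
def map (hjk : ∀ v w : V, C (j v) (j w) = k (B v w)) : Heisenberg B →* Heisenberg C where
  toFun h := ⟨j h.v, k h.t⟩
  map_one' := by
    apply Heisenberg.ext
    · exact map_zero j
    · exact map_zero k
  map_mul' a b := by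
    apply Heisenberg.ext
    · exact map_add j a.v b.v
    · show k (a * b).t = k a.t + k b.t + C (j a.v) (j b.v)
      rw [Heisenberg.mul_t, map_add, map_add, hjk]

variable {C j k} (hjk : ∀ v w : V, C (j v) (j w) = k (B v w))

/-- `map` on the `V`-component. [cite: Weil1964, Chap. I n° 3–4] -/
@[simp] theorem map_apply_v (h : Heisenberg B) : (map C j k hjk h).v = j h.v := rfl

/-- `map` on the central component. [cite: Weil1964, Chap. I n° 3–4] -/
@[simp] theorem map_apply_t (h : Heisenberg B) : (map C j k hjk h).t = k h.t := rfl

/-- `map` carries the centre to the centre. [cite: Weil1964, Chap. I n° 3–4] -/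
theorem map_ofCenter (t : R) :
    map C j k hjk (ofCenter B (Multiplicative.ofAdd t)) = ofCenter C (Multiplicative.ofAdd (k t)) := by
  apply Heisenberg.ext
  · exact map_zero j
  · rfl

/-- `map` is injective when `j` and `k` are. [cite: Weil1964, Chap. I n° 3–4] -/
theorem map_injective (hj : Function.Injective j) (hk : Function.Injective k) :
    Function.Injective (map C j k hjk) := by
  intro a b hab
  apply Heisenberg.ext
  · exact hj (congrArg Heisenberg.v hab)
  · exact hk (congrArg Heisenberg.t hab)

end Map

/-! ### Transport along a linear equivalence -/

variable {V' : Type*} [AddCommGroup V'] [Module R V'] (e : V ≃ₗ[R] V') (C : V' →ₗ[R] V' →ₗ[R] R)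

/-- **transport of structure**: a linear equivalence `e : V ≃ V'` identifies the Heisenberg group of the pulled-back
form `C(e v, e w)` on `V` with that of `C` on `V'`, by `(v, t) ↦ (e v, t)` (e.g. a Darboux basis `V ≃ X × Y` of a
symplectic space). [cite: Weil1964, Chap. I n° 3–4] -/
def congrEquiv : Heisenberg (C.compl₁₂ (e : V →ₗ[R] V') (e : V →ₗ[R] V')) ≃* Heisenberg C where
  toFun h := ⟨e h.v, h.t⟩
  invFun h := ⟨e.symm h.v, h.t⟩
  left_inv h := by
    apply Heisenberg.ext
    · exact e.symm_apply_apply h.v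
    · rfl
  right_inv h := by
    apply Heisenberg.ext
    · exact e.apply_symm_apply h.v
    · rfl
  map_mul' a b := by
    apply Heisenberg.ext
    · exact map_add e a.v b.v
    · show (a * b).t = a.t + b.t + C (e a.v) (e b.v)
      rw [Heisenberg.mul_t, LinearMap.compl₁₂_apply]
      rfl

/-- `congrEquiv` acts by `e` on the `V`-component. [cite: Weil1964, Chap. I n° 3–4] -/
@[simp] theorem congrEquiv_apply_v (h : Heisenberg (C.compl₁₂ (e : V →ₗ[R] V') (e : V →ₗ[R] V'))) :
    (congrEquiv e C h).v = e h.v := rfl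

/-- `congrEquiv` is the identity on the central component. [cite: Weil1964, Chap. I n° 3–4] -/
@[simp] theorem congrEquiv_apply_t (h : Heisenberg (C.compl₁₂ (e : V →ₗ[R] V') (e : V →ₗ[R] V'))) :
    (congrEquiv e C h).t = h.t := rfl

/-- `congrEquiv` is the identity on the centre. [cite: Weil1964, Chap. I n° 3–4] -/
theorem congrEquiv_ofCenter (t : Multiplicative R) :
    congrEquiv e C (ofCenter _ t) = ofCenter C t := by
  apply Heisenberg.ext
  · exact map_zero e
  · rfl

end Heisenberg

/-! ## §2 The symplectic law `½φ` of a polarised symplectic space versus the polarised law -/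

section Polar

variable {X Y : Type*} [AddCommGroup X] [Module R X] [AddCommGroup Y] [Module R Y] (β : X →ₗ[R] Y →ₗ[R] R)

/-- **the alternating form of a polarised pairing**: `altPolar β ((x, y), (x', y')) = β x y' - β x' y`, i.e.
`polar β - (polar β)ᵀ` — the symplectic form `φ` of `W = X ⊕ Y` for which `X`, `Y` are complementary Lagrangians in
duality by `β`. [cite: MoeglinVignerasWaldspurger1987, Chap. 2 I.1] -/
def altPolar : (X × Y) →ₗ[R] (X × Y) →ₗ[R] R :=
  polar β - (polar β).flip

/-- `altPolar β p q = β p.1 q.2 - β q.1 p.2`. [cite: MoeglinVignerasWaldspurger1987, Chap. 2 I.1] -/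
@[simp] theorem altPolar_apply (p q : X × Y) : altPolar β p q = β p.1 q.2 - β q.1 p.2 := by
  simp only [altPolar, LinearMap.sub_apply, LinearMap.flip_apply, polar_apply]

/-- `altPolar β` is alternating. [cite: MoeglinVignerasWaldspurger1987, Chap. 2 I.1] -/
theorem altPolar_self (p : X × Y) : altPolar β p p = 0 := by
  rw [altPolar_apply, sub_self]

/-- `X × 0` is isotropic for `altPolar β`. [cite: MoeglinVignerasWaldspurger1987, Chap. 2 I.1] -/
theorem altPolar_inl_inl (x x' : X) : altPolar β (x, 0) (x', 0) = 0 := by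
  simp

/-- `0 × Y` is isotropic for `altPolar β`. [cite: MoeglinVignerasWaldspurger1987, Chap. 2 I.1] -/
theorem altPolar_inr_inr (y y' : Y) : altPolar β (0, y) (0, y') = 0 := by
  simp

variable [Invertible (2 : R)]

/-- the coboundary relation between `½ altPolar β` and `polar β`: `β x y' = ½(β x y' - β x' y) + (q(p + p') - q p - q p')`
with `q(x, y) = ½ β x y`. [cite: MoeglinVignerasWaldspurger1987, Chap. 2 I.1] -/
theorem polar_eq_half_altPolar_add (p p' : X × Y) :
    polar β p p' = ((⅟(2 : R)) • altPolar β) p p' +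
      (⅟(2 : R) * β (p + p').1 (p + p').2 - ⅟(2 : R) * β p.1 p.2 - ⅟(2 : R) * β p'.1 p'.2) := by
  have h2 : (⅟(2 : R)) * 2 = 1 := invOf_mul_self _
  simp only [LinearMap.smul_apply, altPolar_apply, polar_apply, smul_eq_mul, Prod.fst_add, Prod.snd_add, map_add,
    LinearMap.add_apply]
  linear_combination (-(β p.1 p'.2)) * h2

/-- **`H(W) ≅ A(X)`**: for `2` invertible in `R`, the Heisenberg group of the symplectic law `½φ`, `φ = altPolar β`
(MVW's `H(W)`, `W = X ⊕ Y`), is isomorphic to the polarised Heisenberg group `Heisenberg (polar β)` (Weil's `A(X)` with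
additive centre) by `((x, y), t) ↦ ((x, y), t + ½ β x y)`. [cite: MoeglinVignerasWaldspurger1987, Chap. 2 I.1] -/
noncomputable def halfAltPolarEquiv : Heisenberg ((⅟(2 : R)) • altPolar β) ≃* Heisenberg (polar β) :=
  Heisenberg.coboundaryEquiv _ _ (fun p : X × Y => ⅟(2 : R) * β p.1 p.2) (polar_eq_half_altPolar_add β)

/-- `halfAltPolarEquiv` is the identity over `W`. [cite: MoeglinVignerasWaldspurger1987, Chap. 2 I.1] -/
@[simp] theorem halfAltPolarEquiv_apply_v (h : Heisenberg ((⅟(2 : R)) • altPolar β)) :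
    (halfAltPolarEquiv β h).v = h.v := rfl

/-- `halfAltPolarEquiv` shifts the centre coordinate by `½ β x y`. [cite: MoeglinVignerasWaldspurger1987, Chap. 2 I.1] -/
@[simp] theorem halfAltPolarEquiv_apply_t (h : Heisenberg ((⅟(2 : R)) • altPolar β)) :
    (halfAltPolarEquiv β h).t = h.t + ⅟(2 : R) * β h.v.1 h.v.2 := rfl

/-- `halfAltPolarEquiv` is the identity on the centre (central characters are unchanged by the transport).
[cite: MoeglinVignerasWaldspurger1987, Chap. 2 I.1] -/
theorem halfAltPolarEquiv_ofCenter (t : Multiplicative R) :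
    halfAltPolarEquiv β (Heisenberg.ofCenter _ t) = Heisenberg.ofCenter (polar β) t :=
  Heisenberg.coboundaryEquiv_ofCenter _ t

/-- `halfAltPolarEquiv` on the Lagrangian `X`: `((x, 0), 0) ↦ ((x, 0), 0)`. [cite: MoeglinVignerasWaldspurger1987, Chap. 2 I.1] -/
theorem halfAltPolarEquiv_inl (x : X) :
    halfAltPolarEquiv β ⟨(x, 0), 0⟩ = (⟨(x, 0), 0⟩ : Heisenberg (polar β)) := by
  apply Heisenberg.ext
  · rfl
  · show (0 : R) + ⅟(2 : R) * β x 0 = 0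
    rw [map_zero, mul_zero, add_zero]

/-- `halfAltPolarEquiv` on the Lagrangian `Y`: `((0, y), 0) ↦ ((0, y), 0)`. [cite: MoeglinVignerasWaldspurger1987, Chap. 2 I.1] -/
theorem halfAltPolarEquiv_inr (y : Y) :
    halfAltPolarEquiv β ⟨(0, y), 0⟩ = (⟨(0, y), 0⟩ : Heisenberg (polar β)) := by
  apply Heisenberg.ext
  · rfl
  · show (0 : R) + ⅟(2 : R) * β 0 y = 0
    rw [map_zero, LinearMap.zero_apply, mul_zero, add_zero]

end Polar

end Literature.RepresentationTheory.HeisenbergGroup
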